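import Summits.HubbardSuperconductivity.HubbardSuperconductivity.Theorems.ParityGapRigidityIncommensurateRigidityFiniteRange
import Summits.HubbardSuperconductivity.HubbardSuperconductivity.Theorems.ParityGapRigidityParityGapClustering
import HarnessLib

/-!
# Route ParityGapRigidity — what the crux `IncommensurateRigidity` (stmt-2195) can be REPLACED by:
# `EtsTrichotomy` ∧ (parity-gapped, finite-range-normal, d-wave-dominated window) ⟹ the summit

Helper file (`--supports stmt-HubbardSuperconductivity-2195`, line `registered`, lead c9), sequel of
`…FiniteRange` (p168241).

The route's deciding theorem is `closes : ParityGapClustering → IncommensurateRigidity → GappedWindow →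
HubbardSuperconductivity`; `ParityGapClustering` is PROVED (`parityGapClustering_proof`), the crux
`IncommensurateRigidity` (R) is conjecture-class (nine line leads), `GappedWindow` (W) is the window.
This file machine-checks the conditional route obtained by trading R for the programme's filed named
conjecture `AnomalyExhaustion.EtsTrichotomy` (stmt-1458):

  `hubbardSuperconductivity_of_etsTrichotomy_of_window :
      EtsTrichotomy → W′ → HubbardSuperconductivity`,

where the window `W′` is `GappedWindow` with (i) `δ` irrational (free: `W` only asks `∃ δ`), (ii) the
normal-fluctuation clause (H2) read at EVERY finite range `r` (constant `C_r`) instead of range `≤ 1`,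
(iii) the clauses (H3) (finite tower) and (H4) (soft pair staircase) DROPPED, (iv) the parity-gap and
d-wave-dominance clauses verbatim. Proof: the parity gap gives (H1) by `parityGapClustering_proof`;
`yangODLRO_of_etsTrichotomy_of_finiteRangeFluctuations` gives uniform Yang ODLRO; the rest is the
bookkeeping of `closes`, verbatim. So route ParityGapRigidity with R so restated is an honest
CONDITIONAL route on stmt-1458 with a window different from route AnomalyExhaustion's (uniform parity
gap at some coupling, instead of weak coupling). No definitions; nothing vendored.
-/

noncomputable section

namespace Summit.HubbardSuperconductivity.IncommensurateRigidity.Birth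

open scoped BigOperators Matrix ComplexConjugate
open Matrix Filter Topology Literature.MathematicalPhysics.QuantumLattice Literature.Probability.LatticeModels

/-- **Conditional route: `EtsTrichotomy` ∧ W′ ⟹ `HubbardSuperconductivity`.** Hypotheses: the
Hubbard–Else–Thorngren–Senthil trichotomy (stmt-1458, a HYPOTHESIS — route AnomalyExhaustion's named
conjecture); and the window W′: some `U > 0` and IRRATIONAL `δ ∈ (0, 1/2)` at which, uniformly in even
`L`, (PG) the one-particle parity gap about the `(N_L, 0)` ground energy is `≥ 2Δ > 0` (verbatim as in
`GappedWindow`), (H2_fr) for every range `r` the fluctuations of every one-body operator of range `≤ r`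
with coefficients `|a| ≤ 1` are `≤ C_r·L²` in every normalised sector ground state, and (dominance)
`κ·L²·Re v†ρ₂(ψ)v ≤ Re⟨Δ_d†Δ_d⟩_ψ` for every unit `v` (verbatim as in `GappedWindow`). Conclusion: the
summit statement. [folklore] -/
theorem hubbardSuperconductivity_of_etsTrichotomy_of_window :
    Summit.HubbardSuperconductivity.HubbardSuperconductivity.Theses.AnomalyExhaustion.EtsTrichotomy →
    (∃ U : ℝ, 0 < U ∧ ∃ δ ∈ Set.Ioo (0 : ℝ) (1 / 2), Irrational δ ∧
      (∃ Δ : ℝ, 0 < Δ ∧ ∃ L₀ : ℕ, ∀ L ≥ L₀, Even L → ∀ Hm, Hm = hubbardTorus 2 L 1 U →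
        2 * Δ ≤ groundEnergy Hm (2 * ⌊(1 - δ) * (L : ℝ) ^ 2 / 2⌋₊ + 1) +
          groundEnergy Hm (2 * ⌊(1 - δ) * (L : ℝ) ^ 2 / 2⌋₊ - 1) -
          2 * Matrix.minEnergyOn Hm (szSector (2 * ⌊(1 - δ) * (L : ℝ) ^ 2 / 2⌋₊) 0)) ∧
      (∀ r : ℕ, ∃ C : ℝ, ∃ L₀ : ℕ, ∀ L ≥ L₀, Even L → ∀ Hm, Hm = hubbardTorus 2 L 1 U → ∀ ψ,
        IsGroundStateInSector Hm (2 * ⌊(1 - δ) * (L : ℝ) ^ 2 / 2⌋₊) 0 ψ → star ψ ⬝ᵥ ψ = 1 →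
        ∀ a : Orb (FermionTorus 2 L) × Orb (FermionTorus 2 L) → ℂ, (∀ p, ‖a p‖ ≤ 1) →
          (∀ p, a p ≠ 0 → torusDist (ofLex p.1).1.toTorusSite (ofLex p.2).1.toTorusSite ≤ r) →
          (expect (Matrix.conjTranspose (∑ p, a p • (creation p.1 * annihilation p.2)) *
              (∑ p, a p • (creation p.1 * annihilation p.2))) ψ).re -
            ‖expect (∑ p, a p • (creation p.1 * annihilation p.2)) ψ‖ ^ 2 ≤ C * (L : ℝ) ^ 2) ∧
      (∃ κ : ℝ, 0 < κ ∧ ∃ L₀ : ℕ, ∀ (L : ℕ) [NeZero L], L₀ ≤ L → Even L → ∀ Hm,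
        Hm = hubbardTorus 2 L 1 U → ∀ ψ,
        IsGroundStateInSector Hm (2 * ⌊(1 - δ) * (L : ℝ) ^ 2 / 2⌋₊) 0 ψ → star ψ ⬝ᵥ ψ = 1 →
        ∀ v : Orb (FermionTorus 2 L) × Orb (FermionTorus 2 L) → ℂ, star v ⬝ᵥ v = 1 →
          κ * (L : ℝ) ^ 2 * (star v ⬝ᵥ Matrix.mulVec (twoParticleRDM ψ) v).re ≤
            (expect (Matrix.conjTranspose (pairField dWaveFormFactor L) *
              pairField dWaveFormFactor L) ψ).re)) →
    _root_.HubbardSuperconductivity := by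
  classical
  rintro hE ⟨U, hU, δ, hδ, hirr, ⟨Δ, hΔ, L₀, hPG⟩, hH2, ⟨κ, hκ, L₅, hdom⟩⟩
  obtain ⟨C₁, m, hm, hclus⟩ :=
    Summit.HubbardSuperconductivity.HubbardSuperconductivity.Theorems.parityGapClustering_proof U Δ hΔ
  obtain ⟨a, ha, L₁, hY⟩ := yangODLRO_of_etsTrichotomy_of_finiteRangeFluctuations hE U δ hU hδ hirr
    ⟨C₁, m, hm, L₀, fun L hLL hev Hm hHm φ hgs hn =>
      hclus L _ Hm hHm φ hgs hn (hPG L hLL hev Hm hHm)⟩ hH2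
  refine ⟨U, hU, δ, hδ, fun N ψ hyp => ?_⟩
  -- (1) Σ_{x,y ∈ torus} G_L(x,y) = Re⟨Δ_d† Δ_d⟩ at every positive side
  have hsumG : ∀ (L : ℕ) [NeZero L],
      ∑ x : Literature.Probability.LatticeModels.TorusSite 2 L, ∑ y,
          Literature.MathematicalPhysics.QuantumLattice.pairFieldCorr
            Literature.MathematicalPhysics.QuantumLattice.dWaveFormFactor ψ L x y =
        (Literature.MathematicalPhysics.QuantumLattice.expect
          ((Literature.MathematicalPhysics.QuantumLattice.pairField
              Literature.MathematicalPhysics.QuantumLattice.dWaveFormFactor L)ᴴ *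
            Literature.MathematicalPhysics.QuantumLattice.pairField
              Literature.MathematicalPhysics.QuantumLattice.dWaveFormFactor L) (ψ L)).re := by
    intro L _
    obtain ⟨n, rfl⟩ := Nat.exists_eq_succ_of_ne_zero (NeZero.ne L)
    exact Literature.MathematicalPhysics.QuantumLattice.sum_pairFieldCorr_succ _ ψ n
  -- (2) the two-point function of a normalised state is bounded, uniformly in the side
  obtain ⟨B, hupG⟩ : ∃ B : ℝ, ∀ (L : ℕ) [NeZero L], star (ψ L) ⬝ᵥ ψ L = 1 →
      ∀ x y : Literature.Probability.LatticeModels.TorusSite 2 L,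
        Literature.MathematicalPhysics.QuantumLattice.pairFieldCorr
            Literature.MathematicalPhysics.QuantumLattice.dWaveFormFactor ψ L x y ≤ B := by
    refine ⟨(∑ e ∈ insert 0 Literature.MathematicalPhysics.QuantumLattice.unitSteps,
      ‖((Literature.MathematicalPhysics.QuantumLattice.dWaveFormFactor e / Real.sqrt 2 : ℝ) : ℂ)‖ *
        2) ^ 2, ?_⟩
    intro L _ hψ x y
    obtain ⟨n, rfl⟩ := Nat.exists_eq_succ_of_ne_zero (NeZero.ne L)
    exact Literature.MathematicalPhysics.QuantumLattice.pairFieldCorr_succ_le _ ψ n hψ x y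
  -- (3) thresholds: even sides 2k with k ≥ K are ≥ L₁ (rigidity), ≥ L₅ (dominance) and positive
  obtain ⟨K, hK1, hKL₁, hKL₅⟩ : ∃ K : ℕ, 1 ≤ K ∧ L₁ ≤ 2 * K ∧ L₅ ≤ 2 * K :=
    ⟨L₁ + L₅ + 1, by omega, by omega, by omega⟩
  -- (4) two-sided bounds on the normalised fundamental-domain sums along L = 2k, k ≥ K
  have hpt : ∀ k : ℕ, K ≤ k →
      κ * a ≤ (∑ x ∈ Literature.Probability.LatticeModels.halfOpenBox 2 (2 * k),
          ∑ y ∈ Literature.Probability.LatticeModels.halfOpenBox 2 (2 * k),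
            Literature.MathematicalPhysics.QuantumLattice.torusPullback
              (Literature.MathematicalPhysics.QuantumLattice.pairFieldCorr
                Literature.MathematicalPhysics.QuantumLattice.dWaveFormFactor ψ) (2 * k) x y) /
          ((Literature.Probability.LatticeModels.halfOpenBox 2 (2 * k)).card : ℝ) ^ 2 ∧
      (∑ x ∈ Literature.Probability.LatticeModels.halfOpenBox 2 (2 * k),
          ∑ y ∈ Literature.Probability.LatticeModels.halfOpenBox 2 (2 * k),
            Literature.MathematicalPhysics.QuantumLattice.torusPullback
              (Literature.MathematicalPhysics.QuantumLattice.pairFieldCorr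
                Literature.MathematicalPhysics.QuantumLattice.dWaveFormFactor ψ) (2 * k) x y) /
          ((Literature.Probability.LatticeModels.halfOpenBox 2 (2 * k)).card : ℝ) ^ 2 ≤ B := by
    intro k hk
    haveI : NeZero (2 * k) := ⟨by omega⟩
    obtain ⟨hN, hnorm, hgs⟩ := hyp (2 * k) (even_two_mul k)
    rw [hN] at hgs
    obtain ⟨v, hv, hav⟩ := hY (2 * k) (by omega) (even_two_mul k) _ rfl (ψ (2 * k)) hgs hnorm
    have hd := hdom (2 * k) (by omega) (even_two_mul k) _ rfl (ψ (2 * k)) hgs hnorm v hv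
    have hk0 : (0 : ℝ) < ((2 * k : ℕ) : ℝ) := by exact_mod_cast (by omega : 0 < 2 * k)
    have hpos : (0 : ℝ) < ((2 * k : ℕ) : ℝ) ^ 4 := pow_pos hk0 4
    have hcard : (((Literature.Probability.LatticeModels.halfOpenBox 2 (2 * k)).card : ℕ) : ℝ) ^ 2 =
        ((2 * k : ℕ) : ℝ) ^ 4 := by
      rw [Literature.Probability.LatticeModels.card_halfOpenBox]
      push_cast
      ring
    have hnum : (∑ x ∈ Literature.Probability.LatticeModels.halfOpenBox 2 (2 * k),
          ∑ y ∈ Literature.Probability.LatticeModels.halfOpenBox 2 (2 * k),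
            Literature.MathematicalPhysics.QuantumLattice.torusPullback
              (Literature.MathematicalPhysics.QuantumLattice.pairFieldCorr
                Literature.MathematicalPhysics.QuantumLattice.dWaveFormFactor ψ) (2 * k) x y) =
        ∑ x : Literature.Probability.LatticeModels.TorusSite 2 (2 * k), ∑ y,
          Literature.MathematicalPhysics.QuantumLattice.pairFieldCorr
            Literature.MathematicalPhysics.QuantumLattice.dWaveFormFactor ψ (2 * k) x y := by
      simp only [Literature.MathematicalPhysics.QuantumLattice.torusPullback_apply]
      rw [Literature.MathematicalPhysics.QuantumLattice.sum_halfOpenBox_torusProj (2 * k)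
        (fun x => ∑ y ∈ Literature.Probability.LatticeModels.halfOpenBox 2 (2 * k),
          Literature.MathematicalPhysics.QuantumLattice.pairFieldCorr
            Literature.MathematicalPhysics.QuantumLattice.dWaveFormFactor ψ (2 * k) x
              (Literature.Probability.LatticeModels.Torus.proj (2 * k) y))]
      exact Finset.sum_congr rfl fun x _ =>
        Literature.MathematicalPhysics.QuantumLattice.sum_halfOpenBox_torusProj (2 * k) fun y =>
          Literature.MathematicalPhysics.QuantumLattice.pairFieldCorr
            Literature.MathematicalPhysics.QuantumLattice.dWaveFormFactor ψ (2 * k) x y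
    rw [hcard, hnum]
    constructor
    · rw [le_div_iff₀ hpos, hsumG (2 * k)]
      calc κ * a * ((2 * k : ℕ) : ℝ) ^ 4
          = κ * ((2 * k : ℕ) : ℝ) ^ 2 * (a * ((2 * k : ℕ) : ℝ) ^ 2) := by ring
        _ ≤ κ * ((2 * k : ℕ) : ℝ) ^ 2 *
              (star v ⬝ᵥ Matrix.mulVec
                (Literature.MathematicalPhysics.QuantumLattice.twoParticleRDM (ψ (2 * k))) v).re :=
            mul_le_mul_of_nonneg_left hav (mul_nonneg hκ.le (pow_nonneg hk0.le 2))
        _ ≤ _ := hd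
    · rw [div_le_iff₀ hpos]
      calc ∑ x : Literature.Probability.LatticeModels.TorusSite 2 (2 * k), ∑ y,
            Literature.MathematicalPhysics.QuantumLattice.pairFieldCorr
              Literature.MathematicalPhysics.QuantumLattice.dWaveFormFactor ψ (2 * k) x y
          ≤ ∑ x : Literature.Probability.LatticeModels.TorusSite 2 (2 * k),
              ∑ y : Literature.Probability.LatticeModels.TorusSite 2 (2 * k), B :=
            Finset.sum_le_sum fun x _ => Finset.sum_le_sum fun y _ => hupG (2 * k) hnorm x y
        _ = B * ((2 * k : ℕ) : ℝ) ^ 4 := by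
            simp only [Finset.sum_const, Finset.card_univ, Fintype.card_pi, ZMod.card,
              Finset.prod_const, Fintype.card_fin, nsmul_eq_mul]
            push_cast
            ring
  -- (5) conclude: 0 < κ a ≤ liminf of the normalised sums (bounded above by B, so no junk value)
  dsimp only [Literature.Probability.LatticeModels.HasLongRangeOrder]
  refine lt_of_lt_of_le (mul_pos hκ ha) (Filter.le_liminf_of_le ?_ ?_)
  · exact Filter.isCoboundedUnder_ge_of_eventually_le _
      (Filter.eventually_atTop.2 ⟨K, fun k hk => (hpt k hk).2⟩)
  · exact Filter.eventually_atTop.2 ⟨K, fun k hk => (hpt k hk).1⟩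

end Summit.HubbardSuperconductivity.IncommensurateRigidity.Birth

end
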